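import Mathlib
import HarnessLib
import Summits.Ventures.LatticeQCDFlow.Exactness.IMHKernel
import Summits.Ventures.LatticeQCDFlow.Exactness.AdjointKernels

/-!
# LatticeQCDFlow / Exactness — CORRELATED FLOW PROPOSALS ARE EXACT WITH THE PLAIN IMPORTANCE RATIO: any move that is reversible for
# the FLOW law `q` (a partial refresh ∕ Crank–Nicolson step of the latent noise pushed through the flow, any `q`-exact update in flow
# space), accepted with `min(1, w(y)/w(x))`, leaves `π = w·q` invariant on a general state space

HONEST FRAMING: exact (Metropolis-corrected) sampling algorithms for lattice gauge theory;
figures of merit are autocorrelation/cost numbers at stated couplings and volumes; no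
continuum-physics claim.

Venture `LatticeQCDFlow` (cell pub-lqcd), topic `Exactness`, FANOUT row 30 (lean-1 GEN-43, part II of the generation: MOVES IN FLOW SPACE).
NEW WORK of the cell over `IMHKernel` (`imhAcceptE`, `ofReal_mul_imhAcceptE`, `indepMH`) and `AdjointKernels`
(`IsAdjointPair.lintegral_swap`: the functional form of reversibility); no definition is introduced, nothing is cited as a fact.  Printed
counterparts NAMED ONLY: the preconditioned Crank–Nicolson proposal (Cotter–Roberts–Stuart–White, Statist. Sci. 28 (2013)) and its
transport ∕ flow-preconditioned versions ("NeuTra", Hoffman et al. 2019; Gabrié–Rotskoff–Vanden-Eijnden, PNAS 119 (2022) §Local moves);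
Tierney 1998 §2 (the general acceptance ratio when the proposal is reversible for a reference measure).

## Setting (general measurable `Ω`; flow law `q`, a probability measure; weight `w > 0` measurable; `π = w·q`)

PROPOSAL: a Markov kernel `R` on `Ω` that is REVERSIBLE FOR THE FLOW LAW `q` (`Kernel.IsReversible R q`).  Examples: `R = q` itself
(independent re-draw: the plain flow sampler, `const_isReversible_flow`); the image under the flow map of ANY move reversible for the
latent Gaussian — a partial momentum-style refresh `z′ = ρz + √(1 − ρ²)ξ`, a latent random walk Metropolised for the Gaussian, a latent
HMC step; a `q`-preserving measurable involution.  UPDATE from `x`: draw `y ∼ R(x, ·)`, accept with the PLAIN importance ratio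
`a(x, y) = min(1, w(y)/w(x))` — no proposal density enters, because `R`'s asymmetry is exactly balanced by `q`.  Def-free: ANY kernel
`K` with `K(x, B) = ∫_B a(x, y) R(x, dy) + (1 − ∫ a(x, y) R(x, dy))·1_B(x)` (hypothesis `hK`).

## Results [all ours]

* `revProposal_setLIntegral`: the mass flow `∫_A K(x, B) dπ` splits into the off-diagonal flux
  `Φ(A, B) = ∫∫ 1_A(x) 1_B(y) min(w(x), w(y)) R(x, dy) q(dx)` and a diagonal term on `A ∩ B`.
* `revProposal_flux_symm`: `Φ(A, B) = Φ(B, A)` — by the functional form of `q`-reversibility of `R` applied to the symmetric integrand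
  `1_A(x)1_B(y)min(w x, w y)`.
* **`revProposal_isReversible` ∕ `revProposal_invariant`**: EVERY such `K` is `π`-reversible and leaves `π = w·q` invariant — for every flow,
  every positive measurable weight and EVERY `q`-reversible proposal kernel `R`: correlated, local moves in flow space are exact with the
  same accept/reject test as the independence sampler.
* `revProposal_apply_univ`: `K` is Markov; `const_isReversible_flow` + `revProposal_const_eq_indepMH`: with `R = q` the kernel IS `indepMH q w`
  (the plain flow sampler is the memoryless instance).

Not here: rates (a local `R` has no Doeblin constant — the point of correlated proposals is small steps with high acceptance, traded
against autocorrelation; the tree's `OffDiagonalDominationLagOne` orders any two such kernels that are comparable off the diagonal).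
-/

namespace Summit.Ventures.LatticeQCDFlow.Exactness

open MeasureTheory ProbabilityTheory
open scoped ENNReal

variable {Ω : Type*} [MeasurableSpace Ω] {q : Measure Ω} [IsProbabilityMeasure q] {w : Ω → ℝ}

/-! ## §1 The kernel is Markov -/

/-- The acceptance mass against any Markov proposal kernel is at most one. [ours, bookkeeping] -/
theorem lintegral_imhAcceptE_le_one (R : Kernel Ω Ω) [IsMarkovKernel R] (x : Ω) : ∫⁻ y, imhAcceptE w x y ∂(R x) ≤ 1 := by
  calc ∫⁻ y, imhAcceptE w x y ∂(R x) ≤ ∫⁻ _, 1 ∂(R x) := lintegral_mono fun y => imhAcceptE_le_one w x y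
    _ = 1 := by rw [lintegral_const, measure_univ, mul_one]

omit [IsProbabilityMeasure q] in
/-- `K(x, Ω) = 1`. [ours] -/
theorem revProposal_apply_univ (R : Kernel Ω Ω) [IsMarkovKernel R] (K : Kernel Ω Ω)
    (hK : ∀ (x : Ω) {B : Set Ω}, MeasurableSet B → K x B =
      ∫⁻ y in B, imhAcceptE w x y ∂(R x) + (1 - ∫⁻ y, imhAcceptE w x y ∂(R x)) * B.indicator 1 x)
    (x : Ω) : K x Set.univ = 1 := by
  rw [hK x MeasurableSet.univ, Measure.restrict_univ, Set.indicator_univ, Pi.one_apply, mul_one]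
  exact add_tsub_cancel_of_le (lintegral_imhAcceptE_le_one R x)

omit [IsProbabilityMeasure q] in
/-- Hence `K` is a Markov kernel. [ours, bookkeeping] -/
theorem revProposal_isMarkovKernel (R : Kernel Ω Ω) [IsMarkovKernel R] (K : Kernel Ω Ω)
    (hK : ∀ (x : Ω) {B : Set Ω}, MeasurableSet B → K x B =
      ∫⁻ y in B, imhAcceptE w x y ∂(R x) + (1 - ∫⁻ y, imhAcceptE w x y ∂(R x)) * B.indicator 1 x) :
    IsMarkovKernel K :=
  ⟨fun x => ⟨revProposal_apply_univ R K hK x⟩⟩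

/-! ## §2 The mass flow: off-diagonal flux plus diagonal -/

/-- Joint measurability of the rectangle flux integrand `1_A(x)·1_B(y)·min(w x, w y)`. [ours, bookkeeping] -/
theorem measurable_rectFlux (hw : Measurable w) {A B : Set Ω} (hA : MeasurableSet A) (hB : MeasurableSet B) :
    Measurable (Function.uncurry fun x y : Ω =>
      A.indicator (fun _ => (1 : ℝ≥0∞)) x * B.indicator (fun y => ENNReal.ofReal (min (w x) (w y))) y) := by
  have hmin : Measurable fun p : Ω × Ω => ENNReal.ofReal (min (w p.1) (w p.2)) :=
    ((hw.comp measurable_fst).min (hw.comp measurable_snd)).ennreal_ofReal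
  exact ((measurable_const.indicator hA).comp measurable_fst).mul
    (hmin.indicator (measurable_snd hB) : Measurable fun p : Ω × Ω => B.indicator (fun y => ENNReal.ofReal (min (w p.1) (w y))) p.2)

/-- Measurability of `x ↦ ∫_B a(x, y) R(x, dy)`. [ours, bookkeeping] -/
theorem measurable_setLIntegral_imhAcceptE (hw : Measurable w) (R : Kernel Ω Ω) [IsMarkovKernel R] {B : Set Ω}
    (hB : MeasurableSet B) : Measurable fun x => ∫⁻ y in B, imhAcceptE w x y ∂(R x) := by
  have h : Measurable (Function.uncurry fun x y : Ω => B.indicator (fun y => imhAcceptE w x y) y) :=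
    ((measurable_imhAcceptE hw).indicator (measurable_snd hB) :
      Measurable fun p : Ω × Ω => B.indicator (fun y => imhAcceptE w p.1 y) p.2)
  have := h.lintegral_kernel_prod_right (κ := R)
  simpa only [lintegral_indicator hB] using this

omit [IsProbabilityMeasure q] in
/-- **THE MASS FLOW SPLIT**: `∫_A K(x, B) dπ = Φ(A, B) + ∫_{A ∩ B} w(x)(1 − ∫ a(x, ·) dR(x)) q(dx)` with the off-diagonal flux
`Φ(A, B) = ∫∫ 1_A(x) 1_B(y) min(w x, w y) R(x, dy) q(dx)`. [ours] -/
theorem revProposal_setLIntegral (hw : Measurable w) (hw0 : ∀ x, 0 < w x) (R : Kernel Ω Ω) [IsMarkovKernel R] (K : Kernel Ω Ω)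
    (hK : ∀ (x : Ω) {B : Set Ω}, MeasurableSet B → K x B =
      ∫⁻ y in B, imhAcceptE w x y ∂(R x) + (1 - ∫⁻ y, imhAcceptE w x y ∂(R x)) * B.indicator 1 x)
    {A B : Set Ω} (hA : MeasurableSet A) (hB : MeasurableSet B) :
    ∫⁻ x in A, K x B ∂(q.withDensity fun x => ENNReal.ofReal (w x)) =
      (∫⁻ x, ∫⁻ y, A.indicator (fun _ => (1 : ℝ≥0∞)) x * B.indicator (fun y => ENNReal.ofReal (min (w x) (w y))) y ∂(R x) ∂q) +
        ∫⁻ x in B ∩ A, ENNReal.ofReal (w x) * (1 - ∫⁻ y, imhAcceptE w x y ∂(R x)) ∂q := by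
  have hd : Measurable fun x => ENNReal.ofReal (w x) := hw.ennreal_ofReal
  have hKm : Measurable fun x => K x B := Kernel.measurable_coe _ hB
  have hmass : Measurable fun x => ∫⁻ y, imhAcceptE w x y ∂(R x) := by
    simpa only [Measure.restrict_univ] using measurable_setLIntegral_imhAcceptE hw R MeasurableSet.univ
  have hR1 : Measurable fun x => 1 - ∫⁻ y, imhAcceptE w x y ∂(R x) := measurable_const.sub hmass
  have hI : Measurable fun x => ∫⁻ y in B, imhAcceptE w x y ∂(R x) := measurable_setLIntegral_imhAcceptE hw R hB
  rw [setLIntegral_withDensity_eq_setLIntegral_mul _ hd hKm hA]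
  simp only [Pi.mul_apply]
  have hpt : ∀ x, ENNReal.ofReal (w x) * K x B =
      ENNReal.ofReal (w x) * ∫⁻ y in B, imhAcceptE w x y ∂(R x) +
        B.indicator (fun x => ENNReal.ofReal (w x) * (1 - ∫⁻ y, imhAcceptE w x y ∂(R x))) x := by
    intro x
    rw [hK x hB, mul_add]
    congr 1
    by_cases hx : x ∈ B
    · rw [Set.indicator_of_mem hx, Set.indicator_of_mem hx, Pi.one_apply, mul_one]
    · rw [Set.indicator_of_notMem hx, Set.indicator_of_notMem hx, mul_zero, mul_zero]
  simp_rw [hpt]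
  have hind : Measurable (B.indicator fun x => ENNReal.ofReal (w x) * (1 - ∫⁻ y, imhAcceptE w x y ∂(R x))) :=
    (show Measurable fun x => ENNReal.ofReal (w x) * (1 - ∫⁻ y, imhAcceptE w x y ∂(R x)) from hd.mul hR1).indicator hB
  rw [lintegral_add_right _ hind, lintegral_indicator hB, Measure.restrict_restrict hB]
  congr 1
  -- the off-diagonal part as a double integral with indicators
  rw [← lintegral_indicator hA]
  refine lintegral_congr fun x => ?_
  by_cases hx : x ∈ A
  · rw [Set.indicator_of_mem hx]
    simp only [Set.indicator_of_mem hx, one_mul]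
    rw [← lintegral_indicator hB, ← lintegral_const_mul _ ((measurable_imhAcceptE hw).of_uncurry_left.indicator hB)]
    refine lintegral_congr fun y => ?_
    by_cases hy : y ∈ B
    · rw [Set.indicator_of_mem hy, Set.indicator_of_mem hy, ofReal_mul_imhAcceptE hw0]
    · rw [Set.indicator_of_notMem hy, Set.indicator_of_notMem hy, mul_zero]
  · rw [Set.indicator_of_notMem hx]
    simp only [Set.indicator_of_notMem hx, zero_mul, lintegral_zero]

/-! ## §3 Flux symmetry from `q`-reversibility of the proposal -/

/-- **THE OFF-DIAGONAL FLUX IS SYMMETRIC**: `Φ(A, B) = Φ(B, A)` — the functional form of the `q`-reversibility of `R`, applied to the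
symmetric integrand `1_A(x)1_B(y)min(w x, w y)`. [ours] -/
theorem revProposal_flux_symm (hw : Measurable w) (R : Kernel Ω Ω) [IsMarkovKernel R] (hR : Kernel.IsReversible R q)
    {A B : Set Ω} (hA : MeasurableSet A) (hB : MeasurableSet B) :
    ∫⁻ x, ∫⁻ y, A.indicator (fun _ => (1 : ℝ≥0∞)) x * B.indicator (fun y => ENNReal.ofReal (min (w x) (w y))) y ∂(R x) ∂q =
      ∫⁻ x, ∫⁻ y, B.indicator (fun _ => (1 : ℝ≥0∞)) x * A.indicator (fun y => ENNReal.ofReal (min (w x) (w y))) y ∂(R x) ∂q := by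
  rw [(hR.isAdjointPair).lintegral_swap (measurable_rectFlux hw hA hB)]
  refine lintegral_congr fun y => lintegral_congr fun x => ?_
  by_cases hx : x ∈ A <;> by_cases hy : y ∈ B <;>
    simp [Set.indicator_of_mem, Set.indicator_of_notMem, hx, hy, min_comm]

/-! ## §4 Exactness -/

/-- **CORRELATED FLOW PROPOSALS ARE EXACT — DETAILED BALANCE.**  For every flow law `q`, every positive measurable weight `w`, EVERY Markov
kernel `R` reversible for `q`, and any kernel `K` realising "propose from `R`, accept with `min(1, w(y)/w(x))`, else stay": `K` is reversible
with respect to `π = w·q`. [ours] -/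
theorem revProposal_isReversible (hw : Measurable w) (hw0 : ∀ x, 0 < w x) (R : Kernel Ω Ω) [IsMarkovKernel R]
    (hR : Kernel.IsReversible R q) (K : Kernel Ω Ω)
    (hK : ∀ (x : Ω) {B : Set Ω}, MeasurableSet B → K x B =
      ∫⁻ y in B, imhAcceptE w x y ∂(R x) + (1 - ∫⁻ y, imhAcceptE w x y ∂(R x)) * B.indicator 1 x) :
    Kernel.IsReversible K (q.withDensity fun x => ENNReal.ofReal (w x)) := by
  intro A B hA hB
  rw [revProposal_setLIntegral hw hw0 R K hK hA hB, revProposal_setLIntegral hw hw0 R K hK hB hA, Set.inter_comm,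
    revProposal_flux_symm hw R hR hA hB]

/-- **… INVARIANCE**: `π = w·q` is invariant — local, correlated moves in flow space, accepted by the importance ratio alone, sample the
target exactly. [ours] -/
theorem revProposal_invariant (hw : Measurable w) (hw0 : ∀ x, 0 < w x) (R : Kernel Ω Ω) [IsMarkovKernel R]
    (hR : Kernel.IsReversible R q) (K : Kernel Ω Ω)
    (hK : ∀ (x : Ω) {B : Set Ω}, MeasurableSet B → K x B =
      ∫⁻ y in B, imhAcceptE w x y ∂(R x) + (1 - ∫⁻ y, imhAcceptE w x y ∂(R x)) * B.indicator 1 x) :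
    Kernel.Invariant K (q.withDensity fun x => ENNReal.ofReal (w x)) := by
  haveI := revProposal_isMarkovKernel R K hK
  exact (revProposal_isReversible hw hw0 R hR K hK).invariant

/-! ## §5 The memoryless instance: `R = q` gives back the plain flow sampler -/

omit [IsProbabilityMeasure q] in
/-- The independent re-draw from the flow is (trivially) reversible for the flow law: `∫_A q(B) dq = q(A)q(B)`. [ours] -/
theorem const_isReversible_flow : Kernel.IsReversible (Kernel.const Ω q) q := by
  intro A B hA hB
  simp only [Kernel.const_apply, setLIntegral_const]
  rw [mul_comm]

/-- With `R = q` the correlated-proposal kernel IS `indepMH q w`. [ours] -/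
theorem revProposal_const_eq_indepMH (hw : Measurable w) (K : Kernel Ω Ω)
    (hK : ∀ (x : Ω) {B : Set Ω}, MeasurableSet B → K x B =
      ∫⁻ y in B, imhAcceptE w x y ∂((Kernel.const Ω q) x) + (1 - ∫⁻ y, imhAcceptE w x y ∂((Kernel.const Ω q) x)) * B.indicator 1 x) :
    K = indepMH q w :=
  Kernel.ext_iff'.2 fun x B hB => by rw [hK x hB, Kernel.const_apply, indepMH_apply hw x hB]; rfl

end Summit.Ventures.LatticeQCDFlow.Exactness
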